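import Summits.Parity.GeneralizedHardyLittlewood.Theorems.LeeYangFibresRelativeDimOneSplitDefs
import HarnessLib

/-!
# The dictionary identity (crux stmt-Parity-14113 `LeeYangFibres.RelativeDimOne`, line
gallagher-backwards-split, stub `stub_inversion`, PIECE 1)

For the `d = 1` system `sys a b : ψ_i(n) = a_i n + b_i`, a modulus `q ≥ 1`, residues `c`, a box of
shift vectors `B = ∏_i [u_i, u_i + X_i]` and a window `n ∈ [0, W)` on which every moving window is
positive (`1 ≤ a_i n + u_i`), summing `∏_i Λ(a_i n + b_i)` over the coset `b ≡ c (q)` of the box and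
over `n < W` gives EXACTLY

  `Σ_{n<W} ∏_i (ψ(a_i n+u_i+X_i; q, a_i n+c_i) − ψ(a_i n+u_i−1; q, a_i n+c_i))`

(`dictionary_identity`), the left side of `MovingClassMoments`: swap the sums, factor the sum over
the product set `B ∩ (c + qℤ^t) = ∏_i {u_i ≤ x ≤ u_i + X_i, x ≡ c_i (q)}` (`box_filter_modEq`,
`Finset.prod_univ_sum`), and in each coordinate substitute `x ↦ a_i n + x`, an order isomorphism of
progressions (`sum_filter_modEq_vonMangoldt_eq`). We also identify the prime-tuple sum and the
archimedean factor of `sys a b` on the window `K_W = [0, W − 1]`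
(`vonMangoldtSum_sys_window`, `archFactor_sys_window`; the window is written
`Set.Icc (fun _ => (0 : ℝ)) (fun _ => (W : ℝ) - 1)` throughout).
-/

noncomputable section

open scoped BigOperators Classical Topology ArithmeticFunction.vonMangoldt
open Finset Filter MeasureTheory Literature.NumberTheory.Sieve
open Summit.Parity.GeneralizedHardyLittlewood.Cruxes.RelativeDimOne.GallagherBackwards (classPsi)

namespace Summit.Parity.GeneralizedHardyLittlewood.Cruxes.RelativeDimOne.GallagherBackwardsSplit

variable {t : ℕ}

/-! ### Evaluating `sys a b` -/

/-- `ψ_i(n) = a_i n + b_i`. -/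
theorem sys_eval (a b : Fin t → ℤ) (i : Fin t) (n : Fin 1 → ℤ) :
    (sys a b i).eval n = a i * n 0 + b i := by
  simp [sys, AffLinForm.eval]

/-- `ψ_i(x) = a_i x + b_i` over `ℝ`. -/
theorem sys_realEval (a b : Fin t → ℤ) (i : Fin t) (x : Fin 1 → ℝ) :
    (sys a b i).realEval x = a i * x 0 + b i := by
  simp [sys, AffLinForm.realEval]

/-- The coefficient vector of `sys a b` is `a`. -/
theorem coeffs_sys (a b : Fin t → ℤ) : coeffs (sys a b) = a := by
  funext i; rfl

/-- The shift vector of `sys a b` is `b`. -/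
theorem consts_sys (a b : Fin t → ℤ) : consts (sys a b) = b := by
  funext i; rfl

/-! ### The coset of a box is a product of progressions -/

/-- `B ∩ (c + q ℤ^t)` for a box `B = ∏ [u_i, u_i + X_i]` is the product of the progressions
`{u_i ≤ x ≤ u_i + X_i : x ≡ c_i (q)}`. -/
theorem box_filter_modEq (u : Fin t → ℤ) (X : Fin t → ℕ) (q : ℕ) (c : Fin t → ℤ) :
    (box u X).filter (fun b => ∀ i, Int.ModEq q (b i) (c i)) =
      Fintype.piFinset fun i => (Icc (u i) (u i + X i)).filter fun x => Int.ModEq q x (c i) := by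
  ext b
  simp only [box, mem_filter, Fintype.mem_piFinset]
  exact ⟨fun h i => ⟨h.1 i, h.2 i⟩, fun h => ⟨fun i => (h i).1, fun i => (h i).2⟩⟩

/-! ### One progression: `Σ Λ` over `{lo ≤ x ≤ hi, x ≡ c (q)}` is a difference of two `ψ(·; q, r)` -/

/-- `ψ(hi; q, r) − ψ(lo − 1; q, r) = Σ_{lo ≤ m ≤ hi, m % q = r} Λ(m)` for `1 ≤ lo ≤ hi + 1`. -/
theorem classPsi_sub_classPsi (q r lo hi : ℕ) (hlo : 1 ≤ lo) (h : lo ≤ hi + 1) :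
    classPsi hi q r - classPsi (lo - 1) q r =
      ∑ m ∈ (Icc lo hi).filter (fun m => m % q = r), Λ m := by
  have hsplit : Icc 1 hi = Icc 1 (lo - 1) ∪ Icc lo hi := by
    ext m
    simp only [mem_union, mem_Icc]
    omega
  have hdisj : Disjoint ((Icc 1 (lo - 1)).filter (fun m => m % q = r))
      ((Icc lo hi).filter (fun m => m % q = r)) := by
    rw [Finset.disjoint_left]
    intro m hm hm'
    simp only [mem_filter, mem_Icc] at hm hm'
    omega
  unfold classPsi
  rw [hsplit, filter_union, sum_union hdisj]
  ring

/-- The substitution `x ↦ x.toNat` on a progression of positive integers: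
`Σ_{lo ≤ x ≤ hi, x ≡ c (q)} Λ(x) = ψ(hi; q, c mod q) − ψ(lo − 1; q, c mod q)` (`1 ≤ lo ≤ hi + 1`,
`q ≥ 1`). -/
theorem sum_filter_modEq_vonMangoldt_eq {q : ℕ} (hq : 0 < q) (c lo hi : ℤ) (hlo : 1 ≤ lo)
    (h : lo ≤ hi + 1) :
    ∑ x ∈ (Icc lo hi).filter (fun x => Int.ModEq q x c), Λ x.toNat =
      classPsi hi.toNat q (resid q c) - classPsi (lo - 1).toNat q (resid q c) := by
  have hq' : (q : ℤ) ≠ 0 := by exact_mod_cast hq.ne'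
  have hr : ((resid q c : ℕ) : ℤ) = c % q := by
    rw [resid, Int.toNat_of_nonneg (Int.emod_nonneg c hq')]
  have hlo' : (lo - 1).toNat = lo.toNat - 1 := by omega
  rw [hlo', classPsi_sub_classPsi q (resid q c) lo.toNat hi.toNat (by omega) (by omega)]
  symm
  refine Finset.sum_nbij' (fun m : ℕ => (m : ℤ)) (fun x : ℤ => x.toNat) ?_ ?_ ?_ ?_ ?_
  · intro m hm
    simp only [mem_filter, mem_Icc] at hm ⊢
    refine ⟨⟨by omega, by omega⟩, ?_⟩
    rw [Int.ModEq, ← hr, ← hm.2, Int.natCast_mod]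
  · intro x hx
    simp only [mem_filter, mem_Icc] at hx ⊢
    refine ⟨⟨by omega, by omega⟩, ?_⟩
    have hx0 : 0 ≤ x := by omega
    have h1 : ((x.toNat % q : ℕ) : ℤ) = ((resid q c : ℕ) : ℤ) := by
      rw [Int.natCast_mod, Int.toNat_of_nonneg hx0, hr]
      exact hx.2
    exact_mod_cast h1
  · intro m _
    simp
  · intro x hx
    simp only [mem_filter, mem_Icc] at hx
    exact Int.toNat_of_nonneg (by omega)
  · intro m _
    simp

/-- The same after the shift `x ↦ a n + x`: for `1 ≤ a n + u`,
`Σ_{u ≤ x ≤ u + X, x ≡ c (q)} Λ(a n + x) = ψ(a n + u + X; q, a n + c) − ψ(a n + u − 1; q, a n + c)`. -/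
theorem sum_filter_modEq_vonMangoldt_shift {q : ℕ} (hq : 0 < q) (s c u : ℤ) (X : ℕ)
    (hpos : 1 ≤ s + u) :
    ∑ x ∈ (Icc u (u + X)).filter (fun x => Int.ModEq q x c), Λ (s + x).toNat =
      classPsi (s + u + X).toNat q (resid q (s + c)) -
        classPsi (s + u - 1).toNat q (resid q (s + c)) := by
  rw [← sum_filter_modEq_vonMangoldt_eq hq (s + c) (s + u) (s + u + X) hpos (by linarith)]
  refine Finset.sum_nbij' (fun x : ℤ => s + x) (fun y : ℤ => y - s) ?_ ?_ ?_ ?_ ?_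
  · intro x hx
    simp only [mem_filter, mem_Icc] at hx ⊢
    exact ⟨⟨by linarith [hx.1.1], by linarith [hx.1.2]⟩, hx.2.add_left s⟩
  · intro y hy
    simp only [mem_filter, mem_Icc] at hy ⊢
    refine ⟨⟨by linarith [hy.1.1], by linarith [hy.1.2]⟩, ?_⟩
    have h2 : y - s ≡ (s + c) - s [ZMOD q] := hy.2.sub_right s
    simpa using h2
  · intro x _
    ring
  · intro y _
    ring
  · intro x _
    rfl

/-! ### The dictionary identity -/

/-- THE DICTIONARY (exact): summing `∏_i Λ(a_i n + b_i)` over the shifts `b ≡ c (q)` of the box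
`∏_i [u_i, u_i + X_i]` and over `n < W` is the moving multilinear class moment
`Σ_{n<W} ∏_i (ψ(a_i n+u_i+X_i; q, a_i n+c_i) − ψ(a_i n+u_i−1; q, a_i n+c_i))`, provided every moving
window is positive (`1 ≤ a_i n + u_i` for `n < W`). -/
theorem dictionary_identity : ∀ {t : ℕ} (q : ℕ), 0 < q → ∀ (a c u : Fin t → ℤ) (X : Fin t → ℕ) (W : ℕ), (∀ i, ∀ n : ℕ, n < W → 1 ≤ a i * n + u i) → ∑ b ∈ (box u X).filter (fun b => ∀ i, Int.ModEq q (b i) (c i)), ∑ n ∈ Finset.range W, ∏ i, Λ ((a i * n + b i).toNat) = ∑ n ∈ Finset.range W, ∏ i, (classPsi (a i * n + u i + X i).toNat q (resid q (a i * n + c i)) - classPsi (a i * n + u i - 1).toNat q (resid q (a i * n + c i))) := by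
  intro t q hq a c u X W hpos
  rw [Finset.sum_comm]
  refine Finset.sum_congr rfl fun n hn => ?_
  rw [box_filter_modEq, ← Finset.prod_univ_sum (fun i => (Icc (u i) (u i + X i)).filter
      fun x => Int.ModEq q x (c i)) (fun i x => (Λ ((a i * n + x).toNat) : ℝ))]
  refine Finset.prod_congr rfl fun i _ => ?_
  rw [sum_filter_modEq_vonMangoldt_shift hq (a i * n) (c i) (u i) (X i)
      (hpos i n (Finset.mem_range.1 hn))]

/-! ### The window `K_W = [0, W - 1]`: prime-tuple sum and archimedean factor of `sys a b` -/

/-- The window `K_W = [0, W − 1] ⊆ ℝ¹` is convex. -/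
theorem convex_window (W : ℕ) :
    Convex ℝ (Set.Icc (fun _ => (0 : ℝ)) (fun _ => (W : ℝ) - 1) : Set (Fin 1 → ℝ)) :=
  convex_Icc _ _

/-- `K_W ⊆ [-N, N]` when `W ≤ N + 1`. -/
theorem window_subset_realBox {W N : ℕ} (hW : W ≤ N + 1) :
    (Set.Icc (fun _ => (0 : ℝ)) (fun _ => (W : ℝ) - 1) : Set (Fin 1 → ℝ)) ⊆ realBox 1 N := by
  intro x hx
  simp only [Set.mem_Icc, Pi.le_def] at hx
  simp only [realBox, Set.mem_Icc, Pi.le_def]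
  have hW' : (W : ℝ) ≤ N + 1 := by exact_mod_cast hW
  exact ⟨fun j => by linarith [hx.1 j, (Nat.cast_nonneg N : (0 : ℝ) ≤ N)], fun j => by linarith [hx.2 j]⟩

/-- `S(sys a b, K_W) = Σ_{n<W} ∏_i Λ(a_i n + b_i)` (the lattice points of `[0, W − 1]` inside
`[-N, N]` are `0, …, W − 1` when `W ≤ N + 1`). -/
theorem vonMangoldtSum_sys_window (a b : Fin t → ℤ) {W N : ℕ} (hW : W ≤ N + 1) :
    vonMangoldtSum (sys a b) (Set.Icc (fun _ => (0 : ℝ)) (fun _ => (W : ℝ) - 1)) N =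
      ∑ n ∈ Finset.range W, ∏ i, Λ ((a i * n + b i).toNat) := by
  unfold vonMangoldtSum
  symm
  refine Finset.sum_nbij' (fun m : ℕ => fun _ : Fin 1 => (m : ℤ)) (fun n : Fin 1 → ℤ => (n 0).toNat)
    ?_ ?_ ?_ ?_ ?_
  · intro m hm
    rw [Finset.mem_range] at hm
    simp only [Finset.mem_filter]
    refine ⟨?_, ?_⟩
    · simp only [latticeBox, Fintype.mem_piFinset, mem_Icc]
      intro j
      constructor <;> omega
    · simp only [realPoint, Set.mem_Icc, Pi.le_def]
      have : (m : ℝ) + 1 ≤ W := by exact_mod_cast hm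
      exact ⟨fun _ => by exact_mod_cast (Nat.zero_le m), fun _ => by push_cast; linarith⟩
  · intro n hn
    simp only [Finset.mem_filter] at hn
    rw [Finset.mem_range]
    have h2 := hn.2
    simp only [realPoint, Set.mem_Icc, Pi.le_def] at h2
    have h0 : (0 : ℝ) ≤ n 0 := h2.1 0
    have h1 : (n 0 : ℝ) ≤ W - 1 := h2.2 0
    have h0' : (0 : ℤ) ≤ n 0 := by exact_mod_cast h0
    have h1' : ((n 0 : ℤ) : ℝ) + 1 ≤ ((W : ℤ) : ℝ) := by push_cast; linarith
    have h1'' : n 0 + 1 ≤ (W : ℤ) := by exact_mod_cast h1'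
    omega
  · intro m _
    simp
  · intro n hn
    simp only [Finset.mem_filter] at hn
    have h2 := hn.2
    simp only [realPoint, Set.mem_Icc, Pi.le_def] at h2
    have h0 : (0 : ℝ) ≤ n 0 := h2.1 0
    have h0' : (0 : ℤ) ≤ n 0 := by exact_mod_cast h0
    funext j
    rw [Fin.fin_one_eq_zero j, Int.toNat_of_nonneg h0']
  · intro m _
    refine Finset.prod_congr rfl fun i _ => ?_
    rw [intVonMangoldt, sys_eval]

/-- `β_∞(sys a b, K_W) = W − 1` when `W ≥ 1` and every form is positive on `K_W`. -/
theorem archFactor_sys_window (a b : Fin t → ℤ) {W : ℕ} (hW : 1 ≤ W)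
    (hpos : ∀ i, ∀ x : ℝ, 0 ≤ x → x ≤ W - 1 → 0 < (a i : ℝ) * x + b i) :
    archFactor (sys a b) (Set.Icc (fun _ => (0 : ℝ)) (fun _ => (W : ℝ) - 1)) = W - 1 := by
  unfold archFactor
  have hset : (Set.Icc (fun _ => (0 : ℝ)) (fun _ => (W : ℝ) - 1) : Set (Fin 1 → ℝ)) ∩
      {x | ∀ i, 0 < (sys a b i).realEval x} = Set.Icc (fun _ => (0 : ℝ)) (fun _ => (W : ℝ) - 1) := by
    refine Set.inter_eq_left.mpr fun x hx i => ?_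
    simp only [Set.mem_Icc, Pi.le_def] at hx
    show 0 < (sys a b i).realEval x
    rw [sys_realEval]
    exact hpos i (x 0) (hx.1 0) (hx.2 0)
  have hW' : (0 : ℝ) ≤ (W : ℝ) - 1 := by
    have : (1 : ℝ) ≤ W := by exact_mod_cast hW
    linarith
  rw [hset, Real.volume_Icc_pi_toReal (fun _ => hW')]
  simp

end Summit.Parity.GeneralizedHardyLittlewood.Cruxes.RelativeDimOne.GallagherBackwardsSplit
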